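import Mathlib
import Summits.NavierStokesRegularity.OSWSelfSimilar.SheetNSLineTorusCascadeExactHead
import Summits.NavierStokesRegularity.OSWSelfSimilar.SheetNSLineTorusCascadeLinkCertified
import HarnessLib

/-!
# Viscous CLM on the torus (`a = 0`, `σ = 2`): a DATUM-FREE head/tail certificate in the kernel — for every `c ≥ 31ν` the sine
# cascade is unbounded at `t = log 2/ν` and NO classical solution of the MODEL PDE from `−c sin x` exists on `[0, log 2/ν]`

HONEST FRAMING (cell ns-blowup GROUP B «PROFILE SEARCH», zone Z3, row Z3-U addendum A-F2 of `HOME/profile/z3/CENSUS-Z3.md`;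
human rulings D-0035/D-0074; Z3-TWIN lineage): **1-D MODEL (viscous Constantin–Lax–Majda equation `ω_t = ω Hω + ν ω_xx` on `𝕋`,
`H = hilbertTransformCircle`); exact ODE algebra + rational arithmetic, kernel-checked end to end; not Euler, not Navier–Stokes;
«violates: none — MODEL». NO script datum: every inequality below is verified by `norm_num` on rationals.**

WHAT. The static head/tail theorem `unbounded_of_universal_static_base` (`SheetNSLineTorusCascadeLinkCertified`, p516509) needs lower bounds
`A j λ₁^j (1 − ζ_j) ≤ E_j(s)` for the universal head modes `j ≤ k₀` on a window `[α, T]`, plus `12 ≤ A(1 − e^{−L})(1 − (1 + 12Z)/(k₀+1)²)`.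
With the CLOSED FORMS `E_1 = x`, `E_2 = x²(1−x²)/4`, `E_3 = x³(1/24 − x²/16 + x⁶/48)` (`x = e^{−s}`; `SheetNSLineTorusCascadeExactHead`) and
their window bounds this is discharged IN THE KERNEL for `k₀ = 3` with the rational instance
`A = 92/5`, `λ₁ = 1/31`, `α = log(20/17)`, `T = log 2`, `L = 3 log(17/10)` (`e^{−L} = (10/17)³`, `α + L/3 = T`), `ζ_1 = 1577/10000`,
`ζ_2 = ζ_3 = 0` (`Z = 1577/10000`), the window `e^{−s} ∈ [1/2, 17/20]` being cut at `e^{−s} ∈ {39/50, 71/100, 129/200, 117/200, 27/50}`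
(`windows31`); on each piece `E_j(s) ≥ v_b^j g_j(v_a²)` (`univ_two_ge`, `univ_three_ge`) and the eighteen rational inequalities close by
`norm_num` (tightest: mode 1 at the far end, `(92/5)(1/31)(8423/10000) = 0.49995 ≤ 1/2`).

* `base31` — the head base on `[log(20/17), log 2]`; `windows31` — the six-piece cover;
* **`unbounded_of_le_thirtyOne`** — every sine cascade with `0 < ν`, `31ν ≤ c` has `k ↦ e_k(log 2/ν)` unbounded above (was `48ν` at the
  same time, `unbounded_of_le` p498092; cf. `39.52ν` at the earlier time `0.4987/ν`, `SheetNSLineTorusCascadeSpare`);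
* `datum_lt_thirtyOne_of_bounded` — census form;
* **`horizon_lt_log_two_of_le_thirtyOne`** — PDE level (via eng-3's `horizon_lt_of_cascade_unbounded`, p512652): every classical
  `2π`-periodic solution of the MODEL PDE on `[0, T′]` with `ω(0,·) = −c sin`, `0 < ν`, `31ν ≤ c`, has `T′ < log 2/ν`;
  `datum_lt_thirtyOne_of_classicalSolution` — census form.
READING: the datum-free kernel sentence for sine data becomes «global + unique classical solution for c < 12ν (eng-3); NO classical solution
on [0, log 2/ν] for c ≥ 31ν (this file; 48ν in `horizon_lt_log_two_div`), none on [0, 0.4987/ν] for c ≥ 40ν (`…Spare`)»; the same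
architecture with `k₀ = 4` (closed form of `E_4`) would give ≈ 27ν, `k₀ = 6` ≈ 23ν (priced, not typed); the located threshold is `19.7756ν`
and the certified script+kernel bracket `[19.7755478, 19.7766876]ν`. bears_on: LADDER-NS N5 / zone Z3 (row Z3-U) → N1 linear core.
WHAT THIS IS NOT: not NS; no definitions; nothing numerical outside the kernel.
-/

namespace Summit.NavierStokesRegularity.OSWSelfSimilar
namespace SheetNSLineTorusCascade

open Finset Real Set

variable {ν c : ℝ} {e : ℕ → ℝ → ℝ}

/-! ### The window `[log(20/17), log 2]` in six pieces -/

/-- `−log(17/20) = log(20/17)`. -/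
private theorem neg_log_seventeen_twentieths : -Real.log (17 / 20) = Real.log (20 / 17) := by
  rw [← Real.log_inv]; norm_num

/-- `−log(1/2) = log 2`. -/
private theorem neg_log_half : -Real.log (1 / 2) = Real.log 2 := by
  rw [← Real.log_inv]; norm_num

/-- On `[log(20/17), log 2]` the variable `x = e^{−s}` lies in one of six rational pieces of `[1/2, 17/20]`. -/
theorem windows31 {s : ℝ} (hs : s ∈ Icc (Real.log (20 / 17)) (Real.log 2)) :
    ((39 / 50 : ℝ) ≤ exp (-s) ∧ exp (-s) ≤ 17 / 20) ∨ ((71 / 100 : ℝ) ≤ exp (-s) ∧ exp (-s) ≤ 39 / 50) ∨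
    ((129 / 200 : ℝ) ≤ exp (-s) ∧ exp (-s) ≤ 71 / 100) ∨ ((117 / 200 : ℝ) ≤ exp (-s) ∧ exp (-s) ≤ 129 / 200) ∨
    ((27 / 50 : ℝ) ≤ exp (-s) ∧ exp (-s) ≤ 117 / 200) ∨ ((1 / 2 : ℝ) ≤ exp (-s) ∧ exp (-s) ≤ 27 / 50) := by
  have hhi : exp (-s) ≤ 17 / 20 :=
    exp_neg_le_of_neg_log_le (by norm_num) (by rw [neg_log_seventeen_twentieths]; exact hs.1)
  have hlo : (1 / 2 : ℝ) ≤ exp (-s) := le_exp_neg_of_le_neg_log (by norm_num) (by rw [neg_log_half]; exact hs.2)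
  rcases le_total s (-Real.log (39 / 50)) with h1 | h1
  · exact Or.inl ⟨le_exp_neg_of_le_neg_log (by norm_num) h1, hhi⟩
  rcases le_total s (-Real.log (71 / 100)) with h2 | h2
  · exact Or.inr (Or.inl ⟨le_exp_neg_of_le_neg_log (by norm_num) h2, exp_neg_le_of_neg_log_le (by norm_num) h1⟩)
  rcases le_total s (-Real.log (129 / 200)) with h3 | h3
  · exact Or.inr (Or.inr (Or.inl ⟨le_exp_neg_of_le_neg_log (by norm_num) h3, exp_neg_le_of_neg_log_le (by norm_num) h2⟩))
  rcases le_total s (-Real.log (117 / 200)) with h4 | h4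
  · exact Or.inr (Or.inr (Or.inr (Or.inl
      ⟨le_exp_neg_of_le_neg_log (by norm_num) h4, exp_neg_le_of_neg_log_le (by norm_num) h3⟩)))
  rcases le_total s (-Real.log (27 / 50)) with h5 | h5
  · exact Or.inr (Or.inr (Or.inr (Or.inr (Or.inl
      ⟨le_exp_neg_of_le_neg_log (by norm_num) h5, exp_neg_le_of_neg_log_le (by norm_num) h4⟩))))
  · exact Or.inr (Or.inr (Or.inr (Or.inr (Or.inr ⟨hlo, exp_neg_le_of_neg_log_le (by norm_num) h5⟩))))

/-! ### The head base (`k₀ = 3`, `A = 92/5`, `λ₁ = 1/31`, `ζ_1 = 1577/10000`) -/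

/-- **THE HEAD BASE, IN THE KERNEL.** For `j ≤ 3` and `s ∈ [log(20/17), log 2]`:
`(92/5)·j·(1/31)^j·(1 − ζ_j) ≤ E_j(s)` with `ζ_1 = 1577/10000`, `ζ_2 = ζ_3 = 0`. [new here — MODEL] -/
theorem base31 (j : ℕ) (hj : j ≤ 3) {s : ℝ} (hs : s ∈ Icc (Real.log (20 / 17)) (Real.log 2)) :
    (92 / 5 : ℝ) * (j : ℝ) * (1 / 31 : ℝ) ^ j * (1 - (if j = 1 then (1577 / 10000 : ℝ) else 0))
      ≤ cascadeSolution 1 (sineDatum 1) j s := by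
  have hlo : (1 / 2 : ℝ) ≤ exp (-s) := le_exp_neg_of_le_neg_log (by norm_num) (by rw [neg_log_half]; exact hs.2)
  interval_cases j
  · simp
  · have h1 := univ_one_ge hlo
    have hnum : (92 / 5 : ℝ) * ((1 : ℕ) : ℝ) * (1 / 31 : ℝ) ^ 1 * (1 - (if 1 = 1 then (1577 / 10000 : ℝ) else 0)) ≤ 1 / 2 := by
      norm_num
    linarith
  · have hnum : (92 / 5 : ℝ) * ((2 : ℕ) : ℝ) * (1 / 31 : ℝ) ^ 2 * (1 - (if 2 = 1 then (1577 / 10000 : ℝ) else 0)) ≤ 1 / 25 := by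
      norm_num
    refine le_trans hnum ?_
    rcases windows31 hs with ⟨hb, ha⟩ | ⟨hb, ha⟩ | ⟨hb, ha⟩ | ⟨hb, ha⟩ | ⟨hb, ha⟩ | ⟨hb, ha⟩
    all_goals exact le_trans (by norm_num) (univ_two_ge (by norm_num) hb ha (by norm_num))
  · have hnum : (92 / 5 : ℝ) * ((3 : ℕ) : ℝ) * (1 / 31 : ℝ) ^ 3 * (1 - (if 3 = 1 then (1577 / 10000 : ℝ) else 0)) ≤ 1 / 500 := by
      norm_num
    refine le_trans hnum ?_
    rcases windows31 hs with ⟨hb, ha⟩ | ⟨hb, ha⟩ | ⟨hb, ha⟩ | ⟨hb, ha⟩ | ⟨hb, ha⟩ | ⟨hb, ha⟩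
    all_goals exact le_trans (by norm_num) (univ_three_ge (by norm_num) hb ha (by norm_num))

/-! ### The datum-free theorems -/

/-- `e^{−3 log(17/10)} = (10/17)³`. -/
private theorem exp_neg_L31 : exp (-(3 * Real.log (17 / 10))) = (10 / 17 : ℝ) ^ 3 := by
  have h : -(3 * Real.log (17 / 10)) = ((3 : ℕ) : ℝ) * Real.log (10 / 17) := by
    rw [show (10 / 17 : ℝ) = (17 / 10)⁻¹ by norm_num, Real.log_inv]
    push_cast
    ring
  rw [h, Real.exp_nat_mul, Real.exp_log (by norm_num)]

/-- `log(20/17) + (3 log(17/10))/3 = log 2` (the window closes exactly at `T = log 2`). -/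
private theorem window_end31 : Real.log (20 / 17) + 3 * Real.log (17 / 10) / ((3 : ℕ) : ℝ) = Real.log 2 := by
  have h : Real.log (20 / 17) + Real.log (17 / 10) = Real.log 2 := by
    rw [← Real.log_mul (by norm_num) (by norm_num)]
    norm_num
  push_cast
  linarith [h]

/-- **FINITE-TIME BLOW-UP FOR `c ≥ 31ν`, DATUM-FREE (coefficient form).** For every sine cascade with `0 < ν` and `31ν ≤ c` the
sequence `k ↦ e_k(log 2/ν)` is unbounded above (the head/tail certificate `unbounded_of_universal_static_base` with `k₀ = 3`, the head
base `base31` verified in the kernel). Improves `unbounded_of_le` (`48ν`, same time). [new here — MODEL] -/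
theorem unbounded_of_le_thirtyOne (he : IsSineCascade ν c e) (hν : 0 < ν) (hc : 31 * ν ≤ c) :
    ∀ M : ℝ, ∃ k : ℕ, M < e k (Real.log 2 / ν) := by
  have hα : 0 ≤ Real.log (20 / 17) := Real.log_nonneg (by norm_num)
  have hL : 0 < 3 * Real.log (17 / 10) := mul_pos (by norm_num) (Real.log_pos (by norm_num))
  have hζ0 : ∀ j : ℕ, 0 ≤ (fun j : ℕ => if j = 1 then (1577 / 10000 : ℝ) else 0) j := by
    intro j; simp only; split_ifs <;> norm_num
  have hζ1 : ∀ j : ℕ, (fun j : ℕ => if j = 1 then (1577 / 10000 : ℝ) else 0) j ≤ 1 := by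
    intro j; simp only; split_ifs <;> norm_num
  have hζsupp : ∀ j : ℕ, 3 < j → (fun j : ℕ => if j = 1 then (1577 / 10000 : ℝ) else 0) j = 0 := by
    intro j hj
    have : j ≠ 1 := by omega
    simp [this]
  have hZ : ∀ n : ℕ, ∑ j ∈ range (n + 1), (j : ℝ) * (fun j : ℕ => if j = 1 then (1577 / 10000 : ℝ) else 0) j
      ≤ 1577 / 10000 := by
    intro n
    simp only [mul_ite, mul_zero]
    rw [Finset.sum_ite_eq']
    split_ifs <;> norm_num
  have hZk : 1 + 12 * (1577 / 10000 : ℝ) ≤ (((3 : ℕ) : ℝ) + 1) ^ 2 := by norm_num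
  have hAL : 12 ≤ (92 / 5 : ℝ) * (1 - exp (-(3 * Real.log (17 / 10))))
      * (1 - (1 + 12 * (1577 / 10000 : ℝ)) / (((3 : ℕ) : ℝ) + 1) ^ 2) := by
    rw [exp_neg_L31]; norm_num
  have hc' : ν ≤ (1 / 31 : ℝ) * c := by linarith
  have ht : Real.log 2 / ν ∈ Icc ((Real.log (20 / 17) + 3 * Real.log (17 / 10) / ((3 : ℕ) : ℝ)) / ν) (Real.log 2 / ν) := by
    rw [window_end31]
    exact ⟨le_rfl, le_rfl⟩
  exact unbounded_of_universal_static_base (by norm_num : (0 : ℝ) < 92 / 5) (by norm_num : (0 : ℝ) < 1 / 31) hα hL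
    (by norm_num : 1 ≤ 3) (fun j : ℕ => if j = 1 then (1577 / 10000 : ℝ) else 0) hζ0 hζ1 hζsupp hZ hZk hAL
    (fun j hj s hs => base31 j hj hs) hν hc' he ht

/-- **Contrapositive (census form).** A sine cascade bounded in `k` at `t = log 2/ν` (`ν > 0`) has `c < 31ν`. [new here — MODEL] -/
theorem datum_lt_thirtyOne_of_bounded (he : IsSineCascade ν c e) (hν : 0 < ν)
    (hbdd : ∃ M : ℝ, ∀ k : ℕ, e k (Real.log 2 / ν) ≤ M) : c < 31 * ν := by
  by_contra h
  obtain ⟨M, hM⟩ := hbdd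
  obtain ⟨k, hk⟩ := unbounded_of_le_thirtyOne he hν (not_lt.mp h) M
  exact absurd (hM k) (not_le.mpr hk)

/-- **PDE LEVEL, DATUM-FREE: no classical `2π`-periodic solution of `ω_t = ω·Hω + ν ω_xx` from `−c sin x` with `c ≥ 31ν` exists on
`[0, log 2/ν]`** (improves `horizon_lt_log_two_div`, `48ν`). [new here — MODEL] -/
theorem horizon_lt_log_two_of_le_thirtyOne {T : ℝ} {ω ωt ωx ωxx : ℝ → ℝ → ℝ} (h : IsClassicalSolution ν T ω ωt ωx ωxx)
    (hω0 : ∀ x, ω 0 x = -c * Real.sin x) (hν : 0 < ν) (hc : 31 * ν ≤ c) : T < Real.log 2 / ν :=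
  horizon_lt_of_cascade_unbounded h hω0 (div_pos (Real.log_pos (by norm_num)) hν)
    fun e he => unbounded_of_le_thirtyOne he hν hc

/-- **Census form at the PDE level:** a classical solution from `−c sin x` that exists on `[0, T]` with `log 2/ν ≤ T` (`ν > 0`) has
`c < 31ν`. [new here — MODEL] -/
theorem datum_lt_thirtyOne_of_classicalSolution {T : ℝ} {ω ωt ωx ωxx : ℝ → ℝ → ℝ}
    (h : IsClassicalSolution ν T ω ωt ωx ωxx) (hω0 : ∀ x, ω 0 x = -c * Real.sin x) (hν : 0 < ν)
    (hT : Real.log 2 / ν ≤ T) : c < 31 * ν := by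
  by_contra hcon
  exact absurd hT (not_le.mpr (horizon_lt_log_two_of_le_thirtyOne h hω0 hν (not_lt.mp hcon)))

end SheetNSLineTorusCascade
end Summit.NavierStokesRegularity.OSWSelfSimilar
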